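import Mathlib.RingTheory.RootsOfUnity.AlgebraicallyClosed
import Literature.NumberTheory.GaloisRepresentations.GaloisRep
import Literature.NumberTheory.GaloisRepresentations.IntegralGaloisActionProofs
import HarnessLib

/-!
# The cyclotomic character on Frobenius elements: `χ_ℓ(Frob_v) = N v`

Topic `Literature/NumberTheory/GaloisRepresentations` (trunk GalRep vocabulary:
`GaloisRep.cyclotomicCharacter K ℓ : Γ_K →ₜ* ℤ_[ℓ]ˣ`, `absIntegers`,
`HeightOneSpectrum.primesAbove`, `IsArithFrobAt`, `HeightOneSpectrum.residueCard`).  A *proofs*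
file (theorems only).

Serre, *Abelian ℓ-adic representations and elliptic curves* (1968), Ch. I §1.2, Example (the
`ℓ`-adic cyclotomic character `χ_ℓ`): `χ_ℓ` is unramified at every `v ∤ ℓ` and
`χ_ℓ(F_v) = N v` for the (arithmetic) Frobenius `F_v`.  The unramifiedness is the tree's
`Literature.NumberTheory.GaloisRepresentations.FramedGaloisRep.isUnramifiedAt_cyclotomic_holds` (`GaloisRep`); this file proves the value on
Frobenius elements:

* `Literature.NumberTheory.GaloisRepresentations.GaloisRep.cyclotomicCharacter_apply_of_isArithFrobAt` — **`χ_ℓ(σ) = N v`** in `ℤ_ℓ`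
  for an arithmetic Frobenius `σ ∈ Γ_K` at a prime `𝔓 ∣ v` of `\bar ℤ_K` with `ℓ ∉ v`: on every
  `ℓⁿ`-th root of unity `t ∈ K̄` (an algebraic integer) `σ t = t ^ {N v}` exactly, not only
  modulo `𝔓` (Mathlib `AlgHom.IsArithFrobAt.apply_of_pow_eq_one`: roots of unity of order
  prime to the residue characteristic stay distinct modulo `𝔓`; the tree has this step as
  `Literature.NumberTheory.EllipticCurves.smul_eq_pow_residueCard_of_isArithFrobAt` in
  `EllipticCurves/HasseWeilGoodReductionFrobenius`, re-derived inline here to keep the imports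
  of this file inside `GaloisRepresentations`), so `χ_ℓ(σ) ≡ N v (mod ℓⁿ)` by the uniqueness
  clause of Mathlib's `modularCyclotomicCharacter`, and `PadicInt.ext_of_toZModPow` concludes.
* `Literature.NumberTheory.GaloisRepresentations.GaloisRep.cyclotomicCharacter_frob_not_isOfFinOrder` — hence `χ_ℓ(σ)` has infinite
  order (`N v > 1`).

Used (with `Literature.NumberTheory.GaloisRepresentations.TwistedSumDecomposition`) for the
character `μ = ε_p^{-2}` in the proof of Harris–Lan–Taylor–Thorne's Thm. 7.13.

## References

* J.-P. Serre, *Abelian ℓ-adic representations and elliptic curves*, Benjamin (1968), Ch. I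
  §1.2, Example; §2.3. [SerreAbelianLadic1968]
-/

noncomputable section

open scoped NumberField
open IsDedekindDomain Field

namespace Literature.NumberTheory.GaloisRepresentations

variable {K : Type} [Field K] [NumberField K] {ℓ : ℕ} [Fact ℓ.Prime]

/-- **`χ_ℓ(Frob_v) = N v`** (Serre, *Abelian `ℓ`-adic representations*, I-1.2, Example): for a
number field `K`, a prime `ℓ`, a finite place `v ∤ ℓ`, a prime `𝔓 ∣ v` of `\bar ℤ_K` and an
arithmetic Frobenius `σ ∈ Γ_K` at `𝔓`, the `ℓ`-adic cyclotomic character takes the value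
`N v = #(𝓞 K / v)` at `σ` (as an element of `ℤ_ℓ`).  Proof: at every level `ℓⁿ`, `σ` acts on
`μ_{ℓⁿ}(K̄)` by `t ↦ t^{N v}` (Mathlib `AlgHom.IsArithFrobAt.apply_of_pow_eq_one` in `\bar ℤ_K`,
as `ℓⁿ ∉ 𝔓`), so `χ_ℓ(σ) ≡ N v (mod ℓⁿ)` by the uniqueness clause of Mathlib's
`modularCyclotomicCharacter`; conclude by `PadicInt.ext_of_toZModPow`.
[cite: SerreAbelianLadic1968, Ch. I §1.2 (Example: the cyclotomic character)] -/
theorem GaloisRep.cyclotomicCharacter_apply_of_isArithFrobAt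
    {v : HeightOneSpectrum (𝓞 K)} (hv : (ℓ : 𝓞 K) ∉ v.asIdeal)
    {𝔓 : Ideal (absIntegers (𝓞 K) K)} (h𝔓 : 𝔓 ∈ v.primesAbove)
    {σ : absoluteGaloisGroup K} (hσ : IsArithFrobAt (𝓞 K) σ 𝔓) :
    ((GaloisRep.cyclotomicCharacter K ℓ σ : ℤ_[ℓ]ˣ) : ℤ_[ℓ]) = (v.residueCard : ℤ_[ℓ]) := by
  classical
  haveI : NeZero (ℓ : K) := ⟨Nat.cast_ne_zero.mpr (Fact.out : ℓ.Prime).ne_zero⟩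
  refine PadicInt.ext_of_toZModPow.mp fun n ↦ ?_
  rw [map_natCast, GaloisRep.cyclotomicCharacter_apply, cyclotomicCharacter.toZModPow]
  set g := MulSemiringAction.toRingAut (absoluteGaloisGroup K) (AlgebraicClosure K) σ with hg
  symm
  refine modularCyclotomicCharacter.unique (AlgebraicClosure K)
    (HasEnoughRootsOfUnity.natCard_rootsOfUnity (AlgebraicClosure K) (ℓ ^ n)) g
    (c := (v.residueCard : ZMod (ℓ ^ n))) fun t ht ↦ ?_
  -- `g t = σ • t = t ^ N v = t ^ (N v mod ℓⁿ)`
  have htN : ((t : (AlgebraicClosure K)ˣ) : AlgebraicClosure K) ^ ℓ ^ n = 1 := by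
    have := congrArg Units.val ((mem_rootsOfUnity _ t).mp ht)
    simpa using this
  have h1 : g (t : AlgebraicClosure K) = (t : AlgebraicClosure K) ^ v.residueCard := by
    -- `t` is an algebraic integer; Frobenius acts on it exactly by `t ↦ t ^ N v`
    haveI : 𝔓.IsPrime := h𝔓.1
    have hti : IsIntegral (𝓞 K) ((t : (AlgebraicClosure K)ˣ) : AlgebraicClosure K) :=
      IsIntegral.of_pow (pos_of_ne_zero (NeZero.ne (ℓ ^ n))) (by rw [htN]; exact isIntegral_one)
    set x : absIntegers (𝓞 K) K := ⟨_, hti⟩ with hx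
    have hxN : x ^ ℓ ^ n = 1 := Subtype.ext (by simp [hx, htN])
    have hm : ((ℓ ^ n : ℕ) : absIntegers (𝓞 K) K) ∉ 𝔓 := by
      intro h
      apply hv
      rw [h𝔓.2.over, Ideal.mem_under, map_natCast]
      rw [Nat.cast_pow] at h
      exact Ideal.IsPrime.mem_of_pow_mem inferInstance n h
    have h := hσ.apply_of_pow_eq_one hxN hm
    rw [MulSemiringAction.toAlgHom_apply,
      HeightOneSpectrum.card_quotient_under_eq_residueCard h𝔓] at h
    have h' := congrArg (fun z : absIntegers (𝓞 K) K ↦ (z : AlgebraicClosure K)) h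
    rw [hg, MulSemiringAction.toRingAut_apply]
    simpa [hx, integralClosure.coe_smul] using h'
  rw [h1, ZMod.val_natCast]
  conv_lhs => rw [← Nat.div_add_mod v.residueCard (ℓ ^ n), pow_add, pow_mul, htN, one_pow,
    one_mul]

/-- The value of the cyclotomic character at a Frobenius element (`v ∤ ℓ`) has **infinite
order** in `ℤ_ℓˣ` (it is `N v > 1`, and `ℤ_ℓ` has characteristic `0`). [folklore] -/
theorem GaloisRep.cyclotomicCharacter_frob_not_isOfFinOrder
    {v : HeightOneSpectrum (𝓞 K)} (hv : (ℓ : 𝓞 K) ∉ v.asIdeal)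
    {𝔓 : Ideal (absIntegers (𝓞 K) K)} (h𝔓 : 𝔓 ∈ v.primesAbove)
    {σ : absoluteGaloisGroup K} (hσ : IsArithFrobAt (𝓞 K) σ 𝔓) :
    ¬ IsOfFinOrder (GaloisRep.cyclotomicCharacter K ℓ σ) := by
  intro hfin
  obtain ⟨m, hm, hpow⟩ := hfin.exists_pow_eq_one
  have h := congrArg (fun u : ℤ_[ℓ]ˣ ↦ (u : ℤ_[ℓ])) hpow
  simp only [Units.val_pow_eq_pow_val, Units.val_one,
    GaloisRep.cyclotomicCharacter_apply_of_isArithFrobAt hv h𝔓 hσ] at h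
  rw [← Nat.cast_pow, Nat.cast_eq_one, pow_eq_one_iff] at h
  rcases h with h | h
  · exact (ne_of_gt v.one_lt_residueCard) h
  · exact hm.ne' h

end Literature.NumberTheory.GaloisRepresentations
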